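import Summits.AtomisticToContinuum.Crystallization.Theorems.FrustratedLawDichotomyStrainedPatchHomEntrySearchShard

/-!
# TREE SHARDS for the search certificate: `∃ t, treeOK v t (node …) = true` glued by address, literal-box transfer, and the tree the search generates

decomp-a2c hand-1 g24 (crux `AperiodicFrustratedLawGap`, stmt-AtomisticToContinuum-27623; critic rows 907/910/920), sequel of `…HomEntrySearchShard`.
MEASURED (P17, native): a FAILING interior node of the search costs the whole chain (≈ 237 ms: `radOK` 93 + `tableLeafOKP` 36 + fits 78 + tables K/record
≈ 25) while an ACCEPTING leaf costs only the disjuncts up to the one that fires (36–130 ms).  `treeOK` (…HomCertTree) evaluates the verdict at LEAVES ONLY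
(a `split` node just halves), so a shard certified as `treeOK v t c' w' = true` on the literal tree `t` printed by the count run costs ≈ N accepting
evaluations instead of ≈ 2N mixed ones (×3–6).  The ∃-tree facts glue by address exactly like `nodeOK` (children syntactic), search shards convert into
tree shards (`exists_tree_of_searchOK`), and the root fact `∃ t, treeOK v t rootC rootW = true` feeds `…HomEntrySign.fccHalf_of_entryTreeDom` directly. 
* `treeOK_congr`; ★★ `exists_tree_node_of_halves` (children addresses ⇒ parent, split evenness by one kernel `decide`); ★ `exists_tree_node_of_lit` (a tree
  checked on a LITERAL box transfers to the addressed node by pointwise identities); `exists_tree_node_of_nodeOK` (search shards join the ∃-tree currency);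
  `exists_tree_of_node_nil` (root); ★ `searchTree` (the tree the search generates; printed by the count run as the literal of a tree-shard file) with
  `treeOK_of_searchTree`; `treeLeaves`; kernel smoke tests.

All definitions computable; 0 sorry; standard axioms; no instances / notation / `#eval`.  `--supports stmt-AtomisticToContinuum-27623`.
-/

namespace Summit.AtomisticToContinuum.Crystallization.Theorems.FrustratedLawDichotomyStrainedPatchHomEntryTreeShard

open Summit.AtomisticToContinuum.Crystallization.Theorems.FrustratedLawDichotomyStrainedPatchHomCertTree (CertTree treeOK)
open Summit.AtomisticToContinuum.Crystallization.Theorems.FrustratedLawDichotomyStrainedPatchHomEntrySearch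
open Summit.AtomisticToContinuum.Crystallization.Theorems.FrustratedLawDichotomyStrainedPatchHomEntrySearchShard

variable {κ : Type} [DecidableEq κ]


/-- Trees on pointwise-equal boxes agree. [formal bookkeeping] -/
theorem treeOK_congr {v : (κ → ℤ) → (κ → ℤ) → Bool} {t : CertTree κ} {c c' w w' : κ → ℤ} (hc : ∀ k, c k = c' k) (hw : ∀ k, w k = w' k) :
    treeOK v t c w = treeOK v t c' w' := by
  rw [funext hc, funext hw]

/-- ★★ **TREE-SHARD GLUE BY ADDRESS**: certificate trees on the two children addresses give one on the parent (split even, checked in the kernel). [formal bookkeeping] -/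
theorem exists_tree_node_of_halves {v : (κ → ℤ) → (κ → ℤ) → Bool} {sel : ℕ → (κ → ℤ) → (κ → ℤ) → κ} {addr : List Bool} {d : ℕ} {c w : κ → ℤ}
    (hev : nodeEven sel addr d c w = true)
    (hl : ∃ t : CertTree κ, treeOK v t (node sel (false :: addr) d c w).2.1 (node sel (false :: addr) d c w).2.2 = true)
    (hr : ∃ t : CertTree κ, treeOK v t (node sel (true :: addr) d c w).2.1 (node sel (true :: addr) d c w).2.2 = true) :
    ∃ t : CertTree κ, treeOK v t (node sel addr d c w).2.1 (node sel addr d c w).2.2 = true :=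
  exists_tree_split (sel (node sel addr d c w).1 (node sel addr d c w).2.1 (node sel addr d c w).2.2) (of_decide_eq_true hev) hl hr

/-- ★ **A TREE SHARD PROVED ON A LITERAL BOX TRANSFERS TO THE ADDRESSED NODE** (pointwise identification, as `nodeOK_of_lit`). [formal bookkeeping] -/
theorem exists_tree_node_of_lit {v : (κ → ℤ) → (κ → ℤ) → Bool} {sel : ℕ → (κ → ℤ) → (κ → ℤ) → κ} {addr : List Bool} {d : ℕ} {c w : κ → ℤ}
    {c' w' : κ → ℤ} (t : CertTree κ) (hc : ∀ k, (node sel addr d c w).2.1 k = c' k) (hw : ∀ k, (node sel addr d c w).2.2 k = w' k)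
    (h : treeOK v t c' w' = true) : ∃ t : CertTree κ, treeOK v t (node sel addr d c w).2.1 (node sel addr d c w).2.2 = true :=
  ⟨t, by rw [treeOK_congr hc hw]; exact h⟩

/-- A SEARCH shard (`nodeOK`) is in particular a tree shard (mixed plans glue in the ∃-tree currency). [formal bookkeeping] -/
theorem exists_tree_node_of_nodeOK {v : (κ → ℤ) → (κ → ℤ) → Bool} {sel : ℕ → (κ → ℤ) → (κ → ℤ) → κ} {fuel : ℕ} {addr : List Bool} {d : ℕ}
    {c w : κ → ℤ} (h : nodeOK v sel fuel addr d c w = true) :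
    ∃ t : CertTree κ, treeOK v t (node sel addr d c w).2.1 (node sel addr d c w).2.2 = true :=
  exists_tree_of_searchOK v sel fuel _ _ _ h

/-- The empty address is the box itself (root of the ∃-tree glue). [formal bookkeeping] -/
theorem exists_tree_of_node_nil {v : (κ → ℤ) → (κ → ℤ) → Bool} {sel : ℕ → (κ → ℤ) → (κ → ℤ) → κ} {d : ℕ} {c w : κ → ℤ}
    (h : ∃ t : CertTree κ, treeOK v t (node sel [] d c w).2.1 (node sel [] d c w).2.2 = true) : ∃ t : CertTree κ, treeOK v t c w = true :=
  h

/-- ★ **THE TREE THE SEARCH GENERATES** (`none` = the search fails within the fuel): what a native count run prints, per shard, as the literal of a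
tree-shard file.  Same recursion as `searchOK` / `searchLeaves`. -/
def searchTree (v : (κ → ℤ) → (κ → ℤ) → Bool) (sel : ℕ → (κ → ℤ) → (κ → ℤ) → κ) : ℕ → ℕ → (κ → ℤ) → (κ → ℤ) → Option (CertTree κ)
  | 0, _, c, w => if v c w = true then some .leaf else none
  | fuel + 1, d, c, w =>
      if v c w = true then some .leaf
      else if w (sel d c w) % 2 = 0 then
        match searchTree v sel fuel (d + 1) (loC sel d c w) (halfW sel d c w) with
        | none => none
        | some tl =>
          match searchTree v sel fuel (d + 1) (hiC sel d c w) (halfW sel d c w) with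
          | none => none
          | some tr => some (.split (sel d c w) tl tr)
      else none

/-- ★ **THE GENERATED TREE PASSES `treeOK`** (so a printed tree, re-read, is a valid literal certificate of the same box). [formal bookkeeping] -/
theorem treeOK_of_searchTree {v : (κ → ℤ) → (κ → ℤ) → Bool} {sel : ℕ → (κ → ℤ) → (κ → ℤ) → κ} :
    ∀ {fuel d : ℕ} {c w : κ → ℤ} {t : CertTree κ}, searchTree v sel fuel d c w = some t → treeOK v t c w = true
  | 0, d, c, w, t, h => by
    unfold searchTree at h
    split at h
    · cases h
      simpa [treeOK]
    · cases h
  | n + 1, d, c, w, t, h => by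
    unfold searchTree at h
    split at h
    · cases h
      simpa [treeOK]
    · split at h
      · rename_i hv hev
        split at h
        · cases h
        · rename_i tl htl
          split at h
          · cases h
          · rename_i tr htr
            cases h
            have hl := treeOK_of_searchTree htl
            have hr := treeOK_of_searchTree htr
            unfold loC halfW at hl
            unfold hiC halfW at hr
            simp [treeOK, hev, hl, hr]
      · cases h

/-- Number of leaves of a certificate tree (the shard size a tree literal prints with). -/
def treeLeaves {κ : Type} : CertTree κ → ℕ
  | .leaf => 1
  | .split _ l r => treeLeaves l + treeLeaves r

/-- Smoke test (toy verdict): the generated trees of the two depth-1 shards, re-checked by `treeOK` on their LITERAL boxes, transferred to the addresses and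
glued to the root ∃-tree fact; and `searchTree` (leaf count `2` on a shard; its root tree passes `treeOK`; `none` when the fuel is too small). -/
example : ∃ t : CertTree (Fin 1), treeOK (fun _ w : Fin 1 → ℤ => decide (w 0 ≤ 2)) t (fun _ => 0) (fun _ => 8) = true :=
  exists_tree_of_node_nil (sel := fun _ _ _ => 0) (d := 0)
    (exists_tree_node_of_halves (by decide +kernel)
      (exists_tree_node_of_lit (c' := fun _ => -4) (w' := fun _ => 4) (.split 0 .leaf .leaf) (fun k => by fin_cases k; decide +kernel)
        (fun k => by fin_cases k; decide +kernel) (by decide +kernel))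
      (exists_tree_node_of_nodeOK (fuel := 1) (by decide +kernel)))

example : (searchTree (fun _ w : Fin 1 → ℤ => decide (w 0 ≤ 2)) (fun _ _ _ => 0) 1 1 (fun _ => (-4 : ℤ)) (fun _ => 4)).map treeLeaves = some 2 ∧
    ((searchTree (fun _ w : Fin 1 → ℤ => decide (w 0 ≤ 2)) (fun _ _ _ => 0) 2 0 (fun _ => (0 : ℤ)) (fun _ => 8)).map fun t =>
      treeOK (fun _ w : Fin 1 → ℤ => decide (w 0 ≤ 2)) t (fun _ => 0) (fun _ => 8)) = some true ∧
    (searchTree (fun _ w : Fin 1 → ℤ => decide (w 0 ≤ 2)) (fun _ _ _ => 0) 1 0 (fun _ => (0 : ℤ)) (fun _ => 8)).isNone = true := by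
  decide +kernel

/-! ## §2. LITERAL glue (appended, hand-1 g24): no addressed `node` terms inside certificates

MEASURED: evaluating `node sel addr …` at depth ≳ 20 is exponential both natively and in the checkers — `loC`/`hiC`/`halfW` return bare closures,
which the compiler eta-expands, so the split coordinate `sel d c w` is re-evaluated on every coordinate lookup, once per layer (≈ 7^depth; a depth-30
identity `(node rr6 addr 0 rootC rootW).2.2 (0,1) = …` does not close in 180 s, the same at depth 2 closes in seconds; `searchTree` above inherits this
and must not be used for counting — use `searchTreeF`).  Production glue therefore names every interior box LITERALLY (generator-computed integers)
and discharges the halving equations pointwise (`funext (forall_fin3x3 …)`, 27 + 1 one-line kernel `decide`s per interior node, all on depth-1 terms);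
the tree currency needs no selector at interior nodes at all. -/

/-- ★★ **TREE GLUE ON LITERAL BOXES**: certificate trees on the two literal halves `(cl, w')`, `(cr, w')` of the literal box `(c, w)` along ANY
coordinate `k` with even half-width give a certificate tree on `(c, w)`; the three box equations are function equalities dischargeable pointwise. [formal bookkeeping] -/
theorem exists_tree_split_lit {v : (κ → ℤ) → (κ → ℤ) → Bool} {c w cl cr w' : κ → ℤ} (k : κ) (hev : w k % 2 = 0)
    (hcl : cl = Function.update c k (c k - w k / 2)) (hcr : cr = Function.update c k (c k + w k / 2)) (hw' : w' = Function.update w k (w k / 2))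
    (hl : ∃ t : CertTree κ, treeOK v t cl w' = true) (hr : ∃ t : CertTree κ, treeOK v t cr w' = true) : ∃ t : CertTree κ, treeOK v t c w = true := by
  subst hcl hcr hw'
  exact exists_tree_split k hev hl hr

/-- A literal tree checked on a literal box is an ∃-tree fact (the leaf case of the literal glue). [formal bookkeeping] -/
theorem exists_tree_of_treeOK {v : (κ → ℤ) → (κ → ℤ) → Bool} {c w : κ → ℤ} (t : CertTree κ) (h : treeOK v t c w = true) :
    ∃ t : CertTree κ, treeOK v t c w = true :=
  ⟨t, h⟩

/-- ★ **THE TREE THE SEARCH GENERATES, strict form** (children boxes passed as evaluated `Function.update` values exactly as in `searchOK` /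
`searchLeaves`, so the native cost is that of `searchLeaves`): `none` = the search fails within the fuel. -/
def searchTreeF (v : (κ → ℤ) → (κ → ℤ) → Bool) (sel : ℕ → (κ → ℤ) → (κ → ℤ) → κ) : ℕ → ℕ → (κ → ℤ) → (κ → ℤ) → Option (CertTree κ)
  | 0, _, c, w => if v c w = true then some .leaf else none
  | fuel + 1, d, c, w =>
      if v c w = true then some .leaf
      else if w (sel d c w) % 2 = 0 then
        match searchTreeF v sel fuel (d + 1) (Function.update c (sel d c w) (c (sel d c w) - w (sel d c w) / 2))
            (Function.update w (sel d c w) (w (sel d c w) / 2)) with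
        | none => none
        | some tl =>
          match searchTreeF v sel fuel (d + 1) (Function.update c (sel d c w) (c (sel d c w) + w (sel d c w) / 2))
              (Function.update w (sel d c w) (w (sel d c w) / 2)) with
          | none => none
          | some tr => some (.split (sel d c w) tl tr)
      else none

/-- ★ The strictly generated tree passes `treeOK` on its box. [formal bookkeeping] -/
theorem treeOK_of_searchTreeF {v : (κ → ℤ) → (κ → ℤ) → Bool} {sel : ℕ → (κ → ℤ) → (κ → ℤ) → κ} :
    ∀ {fuel d : ℕ} {c w : κ → ℤ} {t : CertTree κ}, searchTreeF v sel fuel d c w = some t → treeOK v t c w = true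
  | 0, d, c, w, t, h => by
    unfold searchTreeF at h
    split at h
    · cases h
      simpa [treeOK]
    · cases h
  | n + 1, d, c, w, t, h => by
    unfold searchTreeF at h
    split at h
    · cases h
      simpa [treeOK]
    · split at h
      · rename_i hv hev
        split at h
        · cases h
        · rename_i tl htl
          split at h
          · cases h
          · rename_i tr htr
            cases h
            have hl := treeOK_of_searchTreeF htl
            have hr := treeOK_of_searchTreeF htr
            simp [treeOK, hev, hl, hr]
      · cases h

/-- Smoke test (toy verdict, one coordinate, root half-width `8`): literal glue of two literal-box tree shards along coordinate `0` (equations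
pointwise by `funext`), and `searchTreeF` generates the passing 4-leaf root tree. -/
example : ∃ t : CertTree (Fin 1), treeOK (fun _ w : Fin 1 → ℤ => decide (w 0 ≤ 2)) t (fun _ => 0) (fun _ => 8) = true :=
  exists_tree_split_lit (cl := fun _ => -4) (cr := fun _ => 4) (w' := fun _ => 4) 0 (by decide +kernel)
    (funext fun k => by fin_cases k; decide +kernel) (funext fun k => by fin_cases k; decide +kernel) (funext fun k => by fin_cases k; decide +kernel)
    (exists_tree_of_treeOK (.split 0 .leaf .leaf) (by decide +kernel)) (exists_tree_of_treeOK (.split 0 .leaf .leaf) (by decide +kernel))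

example : ((searchTreeF (fun _ w : Fin 1 → ℤ => decide (w 0 ≤ 2)) (fun _ _ _ => 0) 2 0 (fun _ => (0 : ℤ)) (fun _ => 8)).map fun t =>
      (treeLeaves t, treeOK (fun _ w : Fin 1 → ℤ => decide (w 0 ≤ 2)) t (fun _ => 0) (fun _ => 8))) = some (4, true) := by
  decide +kernel

end Summit.AtomisticToContinuum.Crystallization.Theorems.FrustratedLawDichotomyStrainedPatchHomEntryTreeShard
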